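import Literature.AlgebraicGeometry.Resolution.RationalMapBaseIdeal
import Literature.AlgebraicGeometry.Resolution.RegularCentreBlowupSeqExtensionIso
import Literature.AlgebraicGeometry.Resolution.ProjectiveModelsModification
import Literature.AlgebraicGeometry.Resolution.RationalMapsOfModels
import Literature.AlgebraicGeometry.Resolution.ProjectiveModelsJoin
import Literature.AlgebraicGeometry.Resolution.RegularLocusDense
import Literature.AlgebraicGeometry.Resolution.ExcellentRingsFieldProofs
import Literature.AlgebraicGeometry.Resolution.AlterationsDimension
import Literature.AlgebraicGeometry.Resolution.BlowupsFlatBaseChange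
import Literature.AlgebraicGeometry.Resolution.ResolutionGlue
import Literature.AlgebraicGeometry.Motives.ProjectiveSpaceFieldPointsBijective
import Literature.AlgebraicGeometry.Motives.RatFnSpec
import Literature.AlgebraicGeometry.Motives.CyclesDimensionFunctionField
import HarnessLib

/-!
# Zariski–Piltant patching, Step 2: making `X₂ ⋯→ X₁` a morphism without losing `Reg X₂`

Topic: `Literature/AlgebraicGeometry/Resolution`. The first step of Zariski's patching of two
projective models in the axiomatic form of Piltant 2013, Prop. 5.1, for the usual regularity
property ("`P = P_reg`"), with Piltant's Axiom 4 (principalization with control of the regular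
locus) supplied by Cossart–Piltant's principalization on regular excellent threefolds
(`CossartPiltant2019Principalization`, Cossart–Piltant 2019 Prop. 4.4 = arXiv v1 Prop. 4.3),
taken as a HYPOTHESIS `(hP : CossartPiltant2019Principalization)` (it is an unproved named fact
of the tree; nothing new is vendored here):

> Piltant 2013, proof of Prop. 5.1, Step 2 (p. 114): "It can be assumed that the rational map
> `η : X₂ ⋯→ X₁` is a morphism. Namely, let `Z` be the … closure of the graph of `η`, so `Z`
> dominates both `X₁` and `X₂` … By (i)' and (ii) of axiom 4 applied to the pair `(X₂, 𝓘)`, there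
> exists a projective birational morphism `π : Z₁ → X₂` such that `𝓘𝒪_{Z₁}` is locally principal
> (hence `π` factorize through `Z`) and `π⁻¹(Reg_P(X₂)) ⊆ Reg_P(Z₁)`. Therefore we may substitute
> `X₂` by … `Z₁`."

`ProjModel.exists_hom_regLe_of_principalization` PROVES: for projective models `M₁, M₂` of
`K/k` (`ProjectiveModels.lean`) with `dim M₂ = 3`, there is a projective model `N` dominating
both (morphisms of models `N → M₁`, `N → M₂`) with `φ₂⁻¹(Reg M₂) ⊆ Reg N` (`Hom.RegLe`). The
ideal `𝓘` is the base ideal of the rational map `M₂ ⋯→ M₁ ⊆ ℙⁿ_k` given by the homogeneous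
coordinates of the generic point of `M₁` (`RationalMapBaseIdeal.lean`, Hartshorne II Example
7.17.3) — this replaces the printed "`Z → X₂` is projective, hence the blowing up along a certain
ideal sheaf" (Hartshorne II Thm. 7.17); `hP` principalizes it on the open `U = Reg M₂` (regular,
excellent, of dimension `3`); the sequence of blowing ups extends to `ρ : X' → M₂` by closures of
centres (`IsRegularCentreBlowupSeq.exists_extension_full`); on the open `W ⊇ ρ⁻¹(U)` where the
base ideal became principal the rational map is a morphism `W → M₁` (`toProjOfVec`,
`isDefinedAt_of_isLocallyPrincipalAt_comap`), so the join `J(X', M₁)` (`ProjModel.join`, the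
closure of the graph) is isomorphic to `X'` over `W` (`isIso_joinFst_morphismRestrict`) and hence
regular over `U`. The finer form `ProjModel.exists_hom_regLe_isIso_of_regPrincipalization` also
records that `N → M₂` is an ISOMORPHISM over every open on which the rational map `M₂ ⋯→ M₁`
is already defined (Piltant's Axiom 4 (iii)). Also PROVED on the way:
`isLocallyPrincipalAt_of_comap_isOpenImmersion`.

## References

* O. Piltant, *An axiomatic version of Zariski's patching theorem*, RACSAM 107 (2013), §2
  Axiom 4, Prop. 5.1 Step 2, Lemma 3.3. [Piltant2013]
* V. Cossart, O. Piltant, J. Algebra 529 (2019), Prop. 4.4 (arXiv v1: Prop. 4.3) and proof of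
  Prop. 4.6, Steps 2–3. [CossartPiltant2019]
* R. Hartshorne, *Algebraic Geometry* (1977), II Example 7.17.3. [Hartshorne1977]
-/

noncomputable section

open CategoryTheory CategoryTheory.Limits AlgebraicGeometry TopologicalSpace IsLocalRing
open Literature.AlgebraicGeometry.Motives
open MvPolynomial HomogeneousLocalization

universe u

namespace Literature.AlgebraicGeometry.Resolution

attribute [local instance] MvPolynomial.gradedAlgebra

/-! ## Local principality along open immersions -/

/-- **Local principality along an open immersion**: if `j^*I` is locally principal at `y` then
`I` is locally principal at `j y` (the stalks agree). [folklore] -/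
theorem isLocallyPrincipalAt_of_comap_isOpenImmersion {U X : Scheme.{u}} [IsLocallyNoetherian X]
    (j : U ⟶ X) [IsOpenImmersion j] (I : X.IdealSheafData) {y : U}
    (h : IsLocallyPrincipalAt (I.comap j) y) : IsLocallyPrincipalAt I (j y) := by
  apply isLocallyPrincipalAt_of_isPrincipal_stalkIdeal
  obtain ⟨g, hg⟩ := h.isPrincipal_stalkIdeal
  replace hg : stalkIdeal (I.comap j) y = Ideal.span {g} := hg
  rw [stalkIdeal_comap_of_isOpenImmersion] at hg
  let e : X.presheaf.stalk (j y) ≃+* U.presheaf.stalk y := (asIso (j.stalkMap y)).commRingCatIsoToRingEquiv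
  have hcomp : e.symm.toRingHom.comp (j.stalkMap y).hom = RingHom.id _ :=
    RingHom.ext fun a => e.symm_apply_apply a
  have : stalkIdeal I (j y) =
      ((stalkIdeal I (j y)).map (j.stalkMap y).hom).map e.symm.toRingHom := by
    rw [Ideal.map_map, hcomp, Ideal.map_id]
  refine ⟨⟨e.symm g, ?_⟩⟩
  rw [this, hg, Ideal.map_span, Set.image_singleton]
  rfl

namespace ProjModel

variable {k K : Type u} [Field k] [Field K] [Algebra k K]

/-! ## The dimension of a projective model is the transcendence degree -/

/-- **`dim M = trdeg_k K` for a projective model `M` of `K/k`** (Görtz–Wedhorn I, Thm. 5.22 (3),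
`Motives.height_top_eq_trdeg`, and `K(M) ≅ K` over `k`). [cite: GortzWedhorn2020, Thm. 5.22 (3)] -/
theorem topologicalKrullDim_eq_of_trdeg (M : ProjModel k K) {d : ℕ} (htr : Algebra.trdeg k K = d) :
    topologicalKrullDim M.X = d := by
  have h := Motives.height_top_eq_trdeg M.π
  have hinst : ((M.X.presheaf.germ ⊤ (genericPoint M.X) trivial).hom.comp
      (M.π.appTop.hom.comp (Scheme.ΓSpecIso (.of k)).inv.hom)).toAlgebra =
        ProjModel.algebraFunctionField M :=
    Algebra.algebra_ext _ _ fun c => (RingHom.congr_fun (algebraMap_functionField_eq_germ M) c).symm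
  rw [hinst, M.funFieldAlgEquiv.trdeg_eq, htr, Cardinal.toNat_natCast] at h
  rw [← Motives.Scheme.height_genericPoint]
  exact h

/-! ## The join is an isomorphism over the domain of definition of `N₂ ⋯→ M₁ ⊆ ℙⁿ` -/

/-- **The join `J(N₂, M₁)` is isomorphic to `N₂` over the open where `N₂ ⋯→ M₁ ⊆ ℙⁿ_k` is
defined** (Piltant 2013, Lemma 3.3: the closure of the graph of a rational map is locally
isomorphic to the source where the map is defined): on such an open the rational map is a
morphism of `k`-schemes compatible with the `K`-points (`exists_hom_of_isDefinedAt`,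
`RationalMapsOfModels.lean`), so `isIso_joinFst_morphismRestrict` applies.
[cite: Piltant2013, Lemma 3.3] -/
theorem isIso_joinFst_morphismRestrict_of_isDefinedAt (N₂ M₁ : ProjModel k K) {n : ℕ}
    (ι₁ : M₁.X ⟶ Proj (Segre.grading (Fin (n + 1)) k)) [IsClosedImmersion ι₁]
    (hι₁ : ι₁ ≫ Segre.toSpec (Fin (n + 1)) k = M₁.π) (w : Fin (n + 1) → K) (hw : w ≠ 0)
    (hgen₁ : M₁.gen ≫ ι₁ = (ProjectiveSpace.pointOfVec k w hw).left)
    (W : N₂.X.Opens) (hWne : (W : Set N₂.X).Nonempty)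
    (hW : ∀ y ∈ W, IsDefinedAt (fun l => N₂.funFieldAlgEquiv.symm (w l)) y) :
    IsIso ((joinFst N₂ M₁).f ∣_ W) := by
  obtain ⟨f₁, hf₁, h₂⟩ := exists_hom_of_isDefinedAt N₂ M₁ ι₁ hι₁ w hw hgen₁ W hWne hW
  exact isIso_joinFst_morphismRestrict W f₁ hf₁ (N₂.genLift hWne) (N₂.genLift_ι hWne) h₂

/-! ## Step 2 of Piltant's Prop. 5.1 for `P = P_reg` -/

/-- **Cossart–Piltant's Prop. 4.4 on a regular open of a projective threefold model**: every
non-zero ideal sheaf on a non-empty open subscheme `U ⊆ Reg M` of a projective model `M` of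
dimension three (a regular, excellent, Noetherian, integral threefold) is principalized by a
sequence of blowing ups along regular centres in the non-locally-principal loci.
[cite: CossartPiltant2019, Prop. 4.4 (arXiv v1: Prop. 4.3)] -/
theorem principalization_opens_of_principalization (hP : CossartPiltant2019Principalization.{u})
    (M : ProjModel k K) (hdim : topologicalKrullDim M.X = 3) (U : M.X.Opens)
    (hU : (U : Set M.X) ⊆ Scheme.regularLocus M.X) (hUne : (U : Set M.X).Nonempty)
    (J : (U : Scheme.{u}).IdealSheafData) (hJ : J ≠ ⊥) :
    ∃ (S' : Scheme.{u}) (σ : S' ⟶ U), IsRegularCentreBlowupSeq σ J ∧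
      IsLocallyPrincipal (J.comap σ) := by
  haveI : Nonempty (U : Scheme.{u}) := hUne.to_subtype
  haveI : IsIntegral (U : Scheme.{u}) := isIntegral_of_isOpenImmersion U.ι
  haveI : CompactSpace (U : Scheme.{u}) :=
    isCompact_iff_compactSpace.mp (NoetherianSpace.isCompact (U : Set M.X))
  haveI : IsNoetherian (U : Scheme.{u}) := ⟨⟩
  have hregU : Scheme.IsRegular (U : Scheme.{u}) := fun x => by
    have hx : (U.ι x) ∈ Scheme.regularLocus M.X := hU (by rw [Scheme.Opens.ι_apply]; exact x.2)
    haveI : IsRegularLocalRing (M.X.presheaf.stalk (U.ι x)) := hx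
    exact IsRegularLocalRing.of_ringEquiv (asIso (U.ι.stalkMap x)).commRingCatIsoToRingEquiv
  have hexcU : Scheme.IsExcellent (U : Scheme.{u}) :=
    Scheme.isExcellent_of_locallyOfFiniteType Stacks07QW_field_holds (U.ι ≫ M.π)
  have hdimU : topologicalKrullDim (U : Scheme.{u}) = 3 :=
    (topologicalKrullDim_opens_eq M.π U hUne).trans hdim
  exact hP (U : Scheme.{u}) hregU hexcU hdimU J hJ

/-- **Piltant's Axiom 4 for `P = P_reg` from Cossart–Piltant's Prop. 4.4**: on a projective model
`M` of dimension three, every non-zero ideal sheaf on the open subscheme `Reg M` (a regular,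
excellent, Noetherian, integral threefold) is principalized by a sequence of blowing ups along
regular centres in the non-locally-principal loci — the input shape of the dimension-free steps
below. [cite: CossartPiltant2019, Prop. 4.4 (arXiv v1: Prop. 4.3)] -/
theorem regPrincipalization_of_principalization (hP : CossartPiltant2019Principalization.{u})
    (M : ProjModel k K) (hdim : topologicalKrullDim M.X = 3) (U : M.X.Opens)
    (hU : (U : Set M.X) = Scheme.regularLocus M.X) (J : (U : Scheme.{u}).IdealSheafData)
    (hJ : J ≠ ⊥) :
    ∃ (S' : Scheme.{u}) (σ : S' ⟶ U), IsRegularCentreBlowupSeq σ J ∧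
      IsLocallyPrincipal (J.comap σ) :=
  principalization_opens_of_principalization hP M hdim U hU.le
    (by rw [hU]; exact (Scheme.dense_regularLocus M.X).nonempty) J hJ

/-- **Zariski–Piltant patching, Step 2, with the isomorphism loci** (Piltant 2013, proof of
Prop. 5.1, Step 2, and Axiom 4 (iii) "`X' → X` is an isomorphism above the open where `𝓘` is
locally principal"): for a closed `k`-immersion `ι₁ : M₁ ↪ ℙⁿ_k` with homogeneous coordinates
`w ∈ Kⁿ⁺¹` of the generic point of `M₁`, if every non-zero ideal sheaf on the open subscheme
`Reg M₂` is principalized by a sequence of blowing ups along regular centres in the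
non-locally-principal loci (`hPr`), then there is a projective model `N₂` with a morphism of models
`ψ : N₂ → M₂` such that, for the join `N = J(N₂, M₁)` (which dominates `M₁` and `M₂`):
`(N → M₂)⁻¹(Reg M₂) ⊆ Reg N`; `ψ` is an isomorphism over every open of `M₂` missing the closure of
the set of REGULAR points of indeterminacy of the rational map `M₂ ⋯→ M₁` (`(w₀ : … : wₙ)` read in
`K(M₂) ≅ K`); and `N → M₂` is an isomorphism over every open on which that rational map is
defined. [cite: Piltant2013, Prop. 5.1 (proof, Step 2); §2 Axiom 4 (iii)] -/
theorem exists_hom_regLe_isIso_of_regPrincipalization (M₁ M₂ : ProjModel k K) {n : ℕ}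
    (ι₁ : M₁.X ⟶ Proj (Segre.grading (Fin (n + 1)) k)) [IsClosedImmersion ι₁]
    (hι₁w : ι₁ ≫ Segre.toSpec (Fin (n + 1)) k = M₁.π) (w : Fin (n + 1) → K) (hw : w ≠ 0)
    (hPw_left : M₁.gen ≫ ι₁ = (ProjectiveSpace.pointOfVec k w hw).left)
    (hPr : ∀ (U : M₂.X.Opens), (U : Set M₂.X) = Scheme.regularLocus M₂.X →
      ∀ J : (U : Scheme.{u}).IdealSheafData, J ≠ ⊥ →
        ∃ (S' : Scheme.{u}) (σ : S' ⟶ U), IsRegularCentreBlowupSeq σ J ∧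
          IsLocallyPrincipal (J.comap σ)) :
    ∃ (N₂ : ProjModel k K) (ψ : N₂.Hom M₂), ((joinFst N₂ M₁).comp ψ).RegLe ∧
      (∀ V : M₂.X.Opens, Disjoint (V : Set M₂.X)
          (closure ({m | ¬ IsDefinedAt (fun l => M₂.funFieldAlgEquiv.symm (w l)) m} ∩
            Scheme.regularLocus M₂.X)) → IsIso (ψ.f ∣_ V)) ∧
      (∀ V : M₂.X.Opens, (∀ m ∈ V, IsDefinedAt (fun l => M₂.funFieldAlgEquiv.symm (w l)) m) →
        IsIso (((joinFst N₂ M₁).comp ψ).f ∣_ V)) := by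
  classical
  /- (2) the rational map `M₂ ⋯→ ℙⁿ_k` given by `w` read in `K(M₂) ≅ K` -/
  let z : Fin (n + 1) → M₂.X.functionField := fun l => M₂.funFieldAlgEquiv.symm (w l)
  have hz : z ≠ 0 := ProjectiveSpace.algHom_comp_ne_zero M₂.funFieldAlgEquiv.symm.toAlgHom hw
  have hz' : ∃ i, z i ≠ 0 := by
    by_contra h
    push Not at h
    exact hz (funext h)
  /- (3) the regular locus `U` of `M₂` (a regular integral open subscheme) -/
  have hqe : Scheme.IsQuasiExcellent M₂.X :=
    (Scheme.isExcellent_of_locallyOfFiniteType Stacks07QW_field_holds M₂.π).isQuasiExcellent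
  obtain ⟨U, hU⟩ := Scheme.exists_opens_coe_eq_regularLocus hqe
  have hUne : (U : Set M₂.X).Nonempty := by
    rw [hU]; exact (Scheme.dense_regularLocus M₂.X).nonempty
  haveI : Nonempty (U : Scheme.{u}) := hUne.to_subtype
  haveI hintU : IsIntegral (U : Scheme.{u}) := isIntegral_of_isOpenImmersion U.ι
  have hregU : Scheme.IsRegular (U : Scheme.{u}) := fun x => by
    have hx : (U.ι x) ∈ Scheme.regularLocus M₂.X := by
      rw [← hU, Scheme.Opens.ι_apply]; exact x.2
    haveI : IsRegularLocalRing (M₂.X.presheaf.stalk (U.ι x)) := hx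
    exact IsRegularLocalRing.of_ringEquiv (asIso (U.ι.stalkMap x)).commRingCatIsoToRingEquiv
  /- (4) the base ideal of the rational map, restricted to `U`, is non-zero -/
  let J : (U : Scheme.{u}).IdealSheafData := (baseIdeal z).comap U.ι
  have hJ : J ≠ ⊥ := by
    intro hbot
    let y : (U : Scheme.{u}) := Classical.arbitrary _
    have h1 : stalkIdeal J y = ⊥ := by rw [hbot, stalkIdeal_bot]
    rw [stalkIdeal_comap_of_isOpenImmersion] at h1
    obtain ⟨b, hb, hb0⟩ := (Submodule.ne_bot_iff _).mp (stalkIdeal_baseIdeal_ne_bot hz' (U.ι y))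
    apply hb0
    have hb' : (U.ι.stalkMap y).hom b ∈
        (stalkIdeal (baseIdeal z) (U.ι y)).map (U.ι.stalkMap y).hom := Ideal.mem_map_of_mem _ hb
    rw [h1, Ideal.mem_bot] at hb'
    exact (asIso (U.ι.stalkMap y)).commRingCatIsoToRingEquiv.injective
      (hb'.trans (map_zero _).symm)
  /- (5) principalize on `U` (Piltant's Axiom 4) and extend to `M₂`, with the iso locus -/
  obtain ⟨S', σ, hσ, hprinc⟩ := hPr U hU J hJ
  obtain ⟨X', ρ, j', hj', hpb, hprop, hint', hbir, hproj, hregS', hover, hisoP⟩ :=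
    hσ.exists_extension_full hregU hJ U.ι
  haveI := hj'
  haveI := hint'
  haveI := hprop
  haveI := hisoP
  haveI : IsLocallyNoetherian X' := LocallyOfFiniteType.isLocallyNoetherian ρ
  haveI : IsIntegral S' := hσ.isIntegral hJ
  /- (6) `X'` as a projective model `N₂` dominating `M₂`, regular over `U` -/
  have hproj₂ : Motives.IsProjectiveOver (Over.mk (ρ ≫ M₂.π) : Motives.SchemeOver k) :=
    hproj k M₂.π M₂.isProjectiveOver
  obtain ⟨U₀, hU₀, hiso⟩ := M₂.exists_nonempty_isIso_morphismRestrict hbir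
  haveI := hiso
  let N₂ : ProjModel k K := ofModification M₂ ρ U₀ hU₀ hproj₂
  let ψ : N₂.Hom M₂ := ofModificationHom M₂ ρ U₀ hU₀ hproj₂
  have hψf : ψ.f = ρ := rfl
  have hregX' : ∀ y : X', ρ y ∈ (U : Set M₂.X) → IsRegularLocalRing (X'.presheaf.stalk y) := by
    intro y hy
    obtain ⟨s', rfl⟩ := hover y (by rwa [Scheme.Opens.range_ι])
    haveI := hregS' s'
    exact IsRegularLocalRing.of_ringEquiv (asIso (j'.stalkMap s')).commRingCatIsoToRingEquiv.symm
  /- (7) the transported rational map `z'` on `X'` is defined over `j'(S') = ρ⁻¹(U)` -/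
  haveI : IsDominant ρ := ψ.isDominant
  let z' : Fin (n + 1) → X'.functionField := fun l => RatFn.functionFieldMap ρ (z l)
  have hz'eq : z' = fun l => N₂.funFieldAlgEquiv.symm (w l) :=
    funext fun l => functionFieldMap_funFieldIso_inv ψ (w l)
  have hdef' : ∀ s' : S', IsDefinedAt z' (j' s') := by
    intro s'
    refine isDefinedAt_of_isLocallyPrincipalAt_comap ρ hz'
      (isLocallyPrincipalAt_of_comap_isOpenImmersion j' _ ?_)
    have h := hprinc s'
    have hJσ : J.comap σ = ((baseIdeal z).comap ρ).comap j' := by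
      change ((baseIdeal z).comap U.ι).comap σ = _
      rw [← Scheme.IdealSheafData.comap_comp, ← Scheme.IdealSheafData.comap_comp, hpb.w]
    rwa [hJσ] at h
  /- (8) the open `W` of definition of `z'`, containing `j'(S')`; the join is `X'` over it -/
  have hz'' : ∃ i, z' i ≠ 0 := by
    obtain ⟨i, hi⟩ := hz'
    exact ⟨i, (map_ne_zero _).mpr hi⟩
  let W : X'.Opens := ⟨{y | IsDefinedAt z' y}, by
    have h := (isClosed_setOf_not_isDefinedAt hz'').isOpen_compl
    rwa [Set.compl_setOf, funext fun x => propext not_not] at h⟩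
  have hWne : (W : Set X').Nonempty := ⟨j' (Classical.arbitrary S'), hdef' _⟩
  have hWdef : ∀ y ∈ W, IsDefinedAt (fun l => N₂.funFieldAlgEquiv.symm (w l)) y :=
    fun y hy => by rw [← hz'eq]; exact hy
  have hisoW : IsIso ((joinFst N₂ M₁).f ∣_ W) :=
    isIso_joinFst_morphismRestrict_of_isDefinedAt N₂ M₁ ι₁ hι₁w w hw hPw_left W hWne hWdef
  /- (9) the closure of the regular indeterminacy locus is the closure of `U.ι(F)`, `F` the
    non-locally-principal locus of `J` -/
  have hF : U.ι '' (nonPrincipalLocus J : Set U) = {m : M₂.X | ¬ IsDefinedAt z m} ∩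
      Scheme.regularLocus M₂.X := by
    ext m
    constructor
    · rintro ⟨u, hu, rfl⟩
      refine ⟨fun hdef => hu ((isLocallyPrincipalAt_baseIdeal hdef).comap U.ι), ?_⟩
      rw [← hU]; exact u.2
    · rintro ⟨hm, hmreg⟩
      rw [← hU] at hmreg
      refine ⟨⟨m, hmreg⟩, fun hu => hm ?_, rfl⟩
      exact (isDefinedAt_iff_isLocallyPrincipalAt (z := z) hz').mpr
        (isLocallyPrincipalAt_of_comap_isOpenImmersion U.ι _ hu)
  refine ⟨N₂, ψ, fun y hy => ?_, fun V hV => ?_, fun V hV => ?_⟩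
  /- (10) regularity over `U` -/
  · rw [Hom.comp_f, Scheme.Hom.comp_apply, hψf] at hy
    have hyU : ρ ((joinFst N₂ M₁).f y) ∈ (U : Set M₂.X) := by rw [hU]; exact hy
    have hyW : (joinFst N₂ M₁).f y ∈ W := by
      obtain ⟨s', hs'⟩ := hover _ (by rwa [Scheme.Opens.range_ι])
      change IsDefinedAt z' ((joinFst N₂ M₁).f y)
      rw [← hs']
      exact hdef' s'
    haveI : IsRegularLocalRing (N₂.X.presheaf.stalk ((joinFst N₂ M₁).f y)) := hregX' _ hyU
    haveI := isIso_stalkMap_of_isIso_morphismRestrict (joinFst N₂ M₁).f W y hyW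
    exact IsRegularLocalRing.of_ringEquiv
      (asIso ((joinFst N₂ M₁).f.stalkMap y)).commRingCatIsoToRingEquiv
  /- (11) `ψ = ρ` is an isomorphism over every open missing the closure of `U.ι(F)` -/
  · have hVP : V ≤ principalOpen U.ι J := by
      intro m hm hmem
      rw [coe_closureImage, hF] at hmem
      exact Set.disjoint_left.mp hV hm hmem
    rw [hψf]
    exact isIso_morphismRestrict_of_le ρ hisoP hVP
  /- (12) `N → M₂ = joinFst ≫ ρ` is an isomorphism over an open `V` of definition: `V` misses the
    closure of `U.ι(F)` (a subset of the closed indeterminacy locus), so `ρ` is an isomorphism over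
    `V`; and `ρ⁻¹(V) ⊆ W`. -/
  · have hVP : V ≤ principalOpen U.ι J := by
      intro m hm hmem
      have hcl : closure (U.ι '' (nonPrincipalLocus J : Set U)) ⊆ {m : M₂.X | ¬ IsDefinedAt z m} :=
        (isClosed_setOf_not_isDefinedAt hz').closure_subset_iff.mpr
          (by rw [hF]; exact Set.inter_subset_left)
      exact hcl hmem (hV m hm)
    haveI hρV : IsIso (ρ ∣_ V) := isIso_morphismRestrict_of_le ρ hisoP hVP
    have hVW : ρ ⁻¹ᵁ V ≤ W := fun y hy => (hV (ρ y) hy : IsDefinedAt z (ρ y)).functionFieldMap ρ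
    have hJW : IsIso ((joinFst N₂ M₁).f ∣_ ρ ⁻¹ᵁ V) := isIso_morphismRestrict_of_le _ hisoW hVW
    have hcomp : ((joinFst N₂ M₁).comp ψ).f = (joinFst N₂ M₁).f ≫ ρ := by rw [Hom.comp_f, hψf]
    rw [hcomp]
    exact @isIso_morphismRestrict_comp _ _ _ (joinFst N₂ M₁).f ρ V hJW hρV

/-- **Zariski–Piltant patching, Step 2, dimension-free form** (Piltant 2013, proof of Prop. 5.1,
Step 2): if every non-zero ideal sheaf on the open subscheme `Reg M₂` is principalized by a
sequence of blowing ups along regular centres in the non-locally-principal loci (Piltant's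
Axiom 4 for `P = P_reg`, hypothesis `hPr`; in dimension three it is
`CossartPiltant2019Principalization`, `regPrincipalization_of_principalization`), then `M₁`,
`M₂` are dominated by a projective model `N` with `φ₂⁻¹(Reg M₂) ⊆ Reg N`.
[cite: Piltant2013, Prop. 5.1 (proof, Step 2)] -/
theorem exists_hom_regLe_of_regPrincipalization (M₁ M₂ : ProjModel k K)
    (hPr : ∀ (U : M₂.X.Opens), (U : Set M₂.X) = Scheme.regularLocus M₂.X →
      ∀ J : (U : Scheme.{u}).IdealSheafData, J ≠ ⊥ →
        ∃ (S' : Scheme.{u}) (σ : S' ⟶ U), IsRegularCentreBlowupSeq σ J ∧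
          IsLocallyPrincipal (J.comap σ)) :
    ∃ (N : ProjModel k K) (_ : N.Hom M₁) (φ₂ : N.Hom M₂), φ₂.RegLe := by
  /- a projective embedding `ι₁ : M₁ ↪ ℙⁿ_k` and homogeneous coordinates `w ∈ Kⁿ⁺¹` of the
    generic point of `M₁` -/
  obtain ⟨n, ι₁', hι₁'⟩ := M₁.isProjectiveOver
  let ι₁ : M₁.X ⟶ Proj (Segre.grading (Fin (n + 1)) k) := ι₁'.left
  haveI : IsClosedImmersion ι₁ := hι₁'
  have hι₁w : ι₁ ≫ Segre.toSpec (Fin (n + 1)) k = M₁.π := Over.w ι₁'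
  let P₁ : AlgPoints (projectiveSpace n k) K := genOver M₁ ≫ ι₁'
  obtain ⟨w, hw, hPw⟩ := ProjectiveSpace.exists_eq_pointOfVec (k := k) (L := K) P₁
  have hPw_left : M₁.gen ≫ ι₁ = (ProjectiveSpace.pointOfVec k w hw).left := by
    rw [← hPw]; rfl
  obtain ⟨N₂, ψ, hreg, -, -⟩ :=
    exists_hom_regLe_isIso_of_regPrincipalization M₁ M₂ ι₁ hι₁w w hw hPw_left hPr
  exact ⟨join N₂ M₁, joinSnd N₂ M₁, (joinFst N₂ M₁).comp ψ, hreg⟩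

/-- **Zariski–Piltant patching, Step 2** (Piltant 2013, proof of Prop. 5.1, Step 2, with Axiom 4
:= Cossart–Piltant's principalization Prop. 4.4 on the regular locus): assuming
`CossartPiltant2019Principalization`, for projective models `M₁, M₂` of `K/k` with `dim M₂ = 3`
there is a projective model `N` of `K/k` dominating `M₁` and `M₂` such that every point of `N`
over a regular point of `M₂` is regular (`φ₂.RegLe`: "`π⁻¹(Reg_P(X₂)) ⊆ Reg_P(Z₁)`" and `Z₁`
dominates `X₁`). [cite: Piltant2013, Prop. 5.1 (proof, Step 2)] -/
theorem exists_hom_regLe_of_principalization (hP : CossartPiltant2019Principalization.{u})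
    (M₁ M₂ : ProjModel k K) (hdim : topologicalKrullDim M₂.X = 3) :
    ∃ (N : ProjModel k K) (_ : N.Hom M₁) (φ₂ : N.Hom M₂), φ₂.RegLe :=
  exists_hom_regLe_of_regPrincipalization M₁ M₂ (regPrincipalization_of_principalization hP M₂ hdim)

/-- **Step 2 for function fields of transcendence degree three** (the form consumed by the
two-model patching hypothesis of `CossartPiltant2019Patching.of_twoModelPatching`, which
quantifies over `K/k` with `trdeg_k K = 3`). [cite: Piltant2013, Prop. 5.1 (proof, Step 2)] -/
theorem exists_hom_regLe_of_principalization_of_trdeg (hP : CossartPiltant2019Principalization.{u})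
    (htr : Algebra.trdeg k K = 3) (M₁ M₂ : ProjModel k K) :
    ∃ (N : ProjModel k K) (_ : N.Hom M₁) (φ₂ : N.Hom M₂), φ₂.RegLe :=
  exists_hom_regLe_of_principalization hP M₁ M₂ (by
    rw [M₂.topologicalKrullDim_eq_of_trdeg htr]; rfl)

end ProjModel

end Literature.AlgebraicGeometry.Resolution

end
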